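import Literature.Computability.Complexity.IrreducibilityLLLGcd
import Literature.LinearAlgebra.Matrix.ListKernel
import HarnessLib

/-!
# A kernel vector modulo `p` by column elimination, as a fold (Berlekamp's null space step)

Support file for the discharge of the named fact
`Literature.Computability.Complexity.lll_monicIrreducible_mem_P` (irreducibility of monic integer
polynomials is decidable in `P`; Lenstra–Lenstra–Lovász 1982, §3). Step (3.1) of LLL82 applies
Berlekamp's algorithm modulo a small prime `p`, whose heart is a nonzero vector of the null space
of Berlekamp's matrix `Q - I` over `𝔽_p` (Knuth §4.6.2, Algorithm N). The tree's
`Literature.LinearAlgebra.Matrix.ListGauss.kerVec` is that null-space program over an abstract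
field, written by structural recursion on the number of columns, with soundness and completeness
proved. A polynomial-time realisation on codes needs the same computation as LOOPS over residues
modulo `p`; this file provides it and proves that it computes `kerVec` over `ZMod p`:

* `elimRowsMod`, `kerFwdStep` (one column: find a pivot row, eliminate, drop the column — or record
  that the column is free), `backSub` (one back-substitution), `kerVecMod p n rows` (forward fold
  over `n` columns, then a backward fold over the recorded pivots);
* `castRows`-lemmas: reduction modulo `p` commutes with every list primitive used;
* **`kerVecMod_eq_kerVec`** (`p` prime): `(kerVecMod p n rows) mod p = kerVec n (rows mod p)`; hence
  `kerVecMod_sound` (a returned vector is nonzero modulo `p` and orthogonal to every row modulo `p`)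
  and `kerVecMod_complete` (if a nonzero solution exists modulo `p`, a vector is returned), transported
  from `ListGauss.dot_eq_zero_of_kerVec_eq_some` / `isSome_kerVec`;
* `reducedRows_kerVecMod`-type bounds: all entries of the output and of the intermediate states lie
  in `[0, p)` (for the machine-level accumulator estimates).

## References

* D. E. Knuth, *The Art of Computer Programming*, Vol. 2, 3rd ed., 1998, §4.6.2, Algorithm N
  (null space algorithm inside Berlekamp's factoring algorithm). [KnuthTAOCP2]
* E. R. Berlekamp, *Factoring polynomials over finite fields*, Bell System Tech. J. 46 (1967).
* A. K. Lenstra, H. W. Lenstra Jr., L. Lovász, Math. Ann. 261 (1982), §3 (3.1). [LenstraLenstraLovasz1982]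
-/

noncomputable section

namespace Literature.Computability.Complexity

open Literature.LinearAlgebra.Matrix.ListGauss

namespace LLLFactoring

/-! ### The program -/

/-- Integer dot product of two lists (truncating). [folklore] -/
def idot (u v : List ℤ) : ℤ := (List.zipWith (· * ·) u v).sum

/-- One elimination step modulo `p`: subtract `(r₀ · piv₀⁻¹) · piv` from every row `r`, reduce,
and drop the first column. [cite: KnuthTAOCP2, §4.6.2, Algorithm N] -/
def elimRowsMod (p : ℕ) (piv : List ℤ) (rows : List (List ℤ)) : List (List ℤ) :=
  rows.map fun r => (List.zipWith (fun a b => (a - r.headD 0 * invMod p (piv.headD 0) * b) % (p : ℤ)) r piv).tail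

/-- The forward state: remaining rows (first columns dropped), the pivot rows found so far (most
recent first), and whether a free column has been met. [folklore] -/
abbrev KerFwd := List (List ℤ) × List (List ℤ) × Bool

/-- One forward step (one column): once a free column was met, idle; otherwise look for a row with
nonzero head modulo `p` — none: the column is free; some `piv`: eliminate with it.
[cite: KnuthTAOCP2, §4.6.2, Algorithm N] -/
def kerFwdStep (p : ℕ) (st : KerFwd) : KerFwd :=
  if st.2.2 then st else
    match st.1.find? (fun r => decide (r.headD 0 % (p : ℤ) ≠ 0)) with
    | none => (st.1, st.2.1, true)
    | some piv => (elimRowsMod p piv st.1, piv :: st.2.1, false)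

/-- The forward run over `n` columns. [cite: KnuthTAOCP2, §4.6.2, Algorithm N] -/
def kerFwdRun (p : ℕ) (n : ℕ) (st : KerFwd) : KerFwd := (List.replicate n ()).foldl (fun st _ => kerFwdStep p st) st

/-- One back-substitution: prepend the coordinate `-(piv₀⁻¹ · ⟨piv.tail, v⟩) mod p`.
[cite: KnuthTAOCP2, §4.6.2, Algorithm N] -/
def backSub (p : ℕ) (piv : List ℤ) (v : List ℤ) : List ℤ :=
  (-(invMod p (piv.headD 0) * idot piv.tail v) % (p : ℤ)) :: v

/-- **A nonzero null vector modulo `p` by column elimination, loop form**: forward over the `n`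
columns, then, if a free column was met after `k` pivots, back-substitute the unit vector of
`𝔽_p^{n-k}` through the pivots. [cite: KnuthTAOCP2, §4.6.2, Algorithm N] -/
def kerVecMod (p n : ℕ) (rows : List (List ℤ)) : Option (List ℤ) :=
  let st := kerFwdRun p n (rows, [], false)
  if st.2.2 then some (st.2.1.foldl (fun v piv => backSub p piv v) (1 :: List.replicate (n - st.2.1.length - 1) 0))
  else none

/-! ### Reduction modulo `p` commutes with the primitives -/

section Cast

variable (p : ℕ)

/-- Entrywise reduction of a vector. [folklore] -/
def castVec (v : List ℤ) : List (ZMod p) := v.map fun x => ((x : ℤ) : ZMod p)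

/-- Entrywise reduction of a matrix. [folklore] -/
def castRows (rows : List (List ℤ)) : List (List (ZMod p)) := rows.map (castVec p)

/-- `castVec` on `cons`. [folklore] -/
@[simp] theorem castVec_cons (x : ℤ) (v : List ℤ) : castVec p (x :: v) = ((x : ℤ) : ZMod p) :: castVec p v := rfl

/-- `castVec` on `[]`. [folklore] -/
@[simp] theorem castVec_nil : castVec p [] = [] := rfl

/-- `castRows` on `cons`. [folklore] -/
@[simp] theorem castRows_cons (r : List ℤ) (rows : List (List ℤ)) : castRows p (r :: rows) = castVec p r :: castRows p rows := rfl

/-- `castRows` on `[]`. [folklore] -/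
@[simp] theorem castRows_nil : castRows p [] = [] := rfl

/-- Length of `castVec`. [folklore] -/
@[simp] theorem length_castVec (v : List ℤ) : (castVec p v).length = v.length := List.length_map _

/-- `headD` commutes with reduction. [folklore] -/
theorem headD_castVec (v : List ℤ) : (castVec p v).headD 0 = ((v.headD 0 : ℤ) : ZMod p) := by
  cases v <;> simp [castVec]

/-- `tail` commutes with reduction. [folklore] -/
theorem tail_castVec (v : List ℤ) : (castVec p v).tail = castVec p v.tail := by
  cases v <;> simp [castVec]

/-- `replicate 0` reduces to `replicate 0`. [folklore] -/
theorem castVec_replicate_zero (n : ℕ) : castVec p (List.replicate n 0) = List.replicate n 0 := by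
  simp [castVec]

/-- The nonzero-head test commutes with reduction. [folklore] -/
theorem headTest_castVec (v : List ℤ) :
    decide ((castVec p v).headD 0 ≠ 0) = decide (v.headD 0 % (p : ℤ) ≠ 0) := by
  rw [headD_castVec]
  congr 1
  rw [ne_eq, ne_eq, ZMod.intCast_zmod_eq_zero_iff_dvd, Int.dvd_iff_emod_eq_zero]

variable {p} [hp : Fact p.Prime]

/-- The dot product commutes with reduction. [folklore] -/
theorem cast_idot : ∀ (u v : List ℤ), ((idot u v : ℤ) : ZMod p) = dot (castVec p u) (castVec p v)
  | [], v => by simp [idot]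
  | a :: u, [] => by simp [idot]
  | a :: u, b :: v => by
    rw [castVec_cons, castVec_cons, dot_cons_cons, ← cast_idot u v]
    simp [idot]

/-- The inverse modulo `p` reduces to the field inverse. [folklore] -/
theorem cast_invMod_eq_inv (x : ℤ) (hx : ((x : ℤ) : ZMod p) ≠ 0) : ((invMod p x : ℤ) : ZMod p) = ((x : ℤ) : ZMod p)⁻¹ :=
  eq_inv_of_mul_eq_one_left (cast_invMod_mul hx)

/-- Elimination commutes with reduction (pivot with nonzero head modulo `p`). [folklore] -/
theorem castRows_elimRowsMod (piv : List ℤ) (hpiv : ((piv.headD 0 : ℤ) : ZMod p) ≠ 0) (rows : List (List ℤ)) :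
    castRows p (elimRowsMod p piv rows) = elimRows (castVec p piv) (castRows p rows) := by
  unfold elimRowsMod elimRows castRows
  rw [List.map_map, List.map_map]
  refine List.map_congr_left fun r _ => ?_
  simp only [Function.comp_apply]
  rw [← tail_castVec, headD_castVec, headD_castVec]
  congr 1
  show List.map _ (List.zipWith _ r piv) = List.zipWith _ (List.map _ r) (List.map _ piv)
  rw [List.map_zipWith, List.zipWith_map_left, List.zipWith_map_right]
  refine congrArg (fun f => List.zipWith f r piv) (funext fun a => funext fun b => ?_)
  rw [ZMod.intCast_mod]
  push_cast
  rw [cast_invMod_eq_inv _ hpiv]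

/-- Back-substitution commutes with reduction. [folklore] -/
theorem castVec_backSub (piv : List ℤ) (hpiv : ((piv.headD 0 : ℤ) : ZMod p) ≠ 0) (v : List ℤ) :
    castVec p (backSub p piv v) = (-(((castVec p piv).headD 0)⁻¹ * dot (castVec p piv).tail (castVec p v))) :: castVec p v := by
  rw [backSub, castVec_cons, ZMod.intCast_mod]
  push_cast
  rw [cast_invMod_eq_inv _ hpiv, headD_castVec, tail_castVec, cast_idot]

end Cast

/-! ### The loop computes `kerVec` -/

section Equiv

variable {p : ℕ}

/-- The forward run does not read the pivot list: it appends the new pivots in front of it. [folklore] -/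
theorem kerFwdRun_pivots (rows : List (List ℤ)) (P : List (List ℤ)) : ∀ n : ℕ,
    kerFwdRun p n (rows, P, false) =
      ((kerFwdRun p n (rows, [], false)).1, (kerFwdRun p n (rows, [], false)).2.1 ++ P, (kerFwdRun p n (rows, [], false)).2.2)
  | 0 => by simp [kerFwdRun]
  | n + 1 => by
    -- peel the FIRST step
    have hstep : ∀ (st : KerFwd) (m : ℕ), kerFwdRun p (m + 1) st = kerFwdRun p m (kerFwdStep p st) := by
      intro st m; simp [kerFwdRun, List.replicate_succ]
    rw [hstep, hstep]
    unfold kerFwdStep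
    simp only [Bool.false_eq_true, ↓reduceIte]
    cases hfind : rows.find? (fun r => decide (r.headD 0 % (p : ℤ) ≠ 0)) with
    | none =>
      simp only []
      -- a found free column: the run idles
      have hidle : ∀ (m : ℕ) (rs Q : List (List ℤ)), kerFwdRun p m (rs, Q, true) = (rs, Q, true) := by
        intro m rs Q
        induction m with
        | zero => rfl
        | succ m ih => rw [hstep]; unfold kerFwdStep; simpa using ih
      rw [hidle, hidle]
      simp
    | some piv =>
      simp only []
      rw [kerFwdRun_pivots (elimRowsMod p piv rows) (piv :: P) n, kerFwdRun_pivots (elimRowsMod p piv rows) [piv] n]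
      simp

/-- Idle forward runs. [folklore] -/
theorem kerFwdRun_true (n : ℕ) (rs Q : List (List ℤ)) : kerFwdRun p n (rs, Q, true) = (rs, Q, true) := by
  induction n with
  | zero => rfl
  | succ m ih =>
    have hstep : ∀ (st : KerFwd) (m : ℕ), kerFwdRun p (m + 1) st = kerFwdRun p m (kerFwdStep p st) := by
      intro st m; simp [kerFwdRun, List.replicate_succ]
    rw [hstep]; unfold kerFwdStep; simpa using ih

/-- **The recursion of `kerVec` holds for the loop**: `kerVecMod p (n+1) rows` branches on the
first pivot exactly as `kerVec`. [cite: KnuthTAOCP2, §4.6.2, Algorithm N] -/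
theorem kerVecMod_succ (n : ℕ) (rows : List (List ℤ)) :
    kerVecMod p (n + 1) rows =
      match rows.find? (fun r => decide (r.headD 0 % (p : ℤ) ≠ 0)) with
      | none => some (1 :: List.replicate n 0)
      | some piv => (kerVecMod p n (elimRowsMod p piv rows)).map (backSub p piv) := by
  have hstep : ∀ (st : KerFwd) (m : ℕ), kerFwdRun p (m + 1) st = kerFwdRun p m (kerFwdStep p st) := by
    intro st m; simp [kerFwdRun, List.replicate_succ]
  unfold kerVecMod
  simp only []
  rw [hstep]
  unfold kerFwdStep
  simp only [Bool.false_eq_true, ↓reduceIte]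
  cases hfind : rows.find? (fun r => decide (r.headD 0 % (p : ℤ) ≠ 0)) with
  | none =>
    simp only []
    rw [kerFwdRun_true]
    simp
  | some piv =>
    simp only []
    rw [kerFwdRun_pivots]
    simp only [List.foldl_append, List.foldl_cons, List.foldl_nil, List.length_append, List.length_singleton,
      Nat.add_sub_add_right]
    split_ifs with h <;> rfl

/-- Pivots returned by `find?` have nonzero head modulo `p`. [folklore] -/
theorem head_ne_zero_of_find {rows : List (List ℤ)} {piv : List ℤ}
    (h : rows.find? (fun r => decide (r.headD 0 % (p : ℤ) ≠ 0)) = some piv) : ((piv.headD 0 : ℤ) : ZMod p) ≠ 0 := by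
  have := List.find?_some h
  simp only [ne_eq, decide_eq_true_eq] at this
  rwa [ne_eq, ZMod.intCast_zmod_eq_zero_iff_dvd, Int.dvd_iff_emod_eq_zero]

variable [hp : Fact p.Prime]

/-- **The loop computes `kerVec` over `𝔽_p`** (`p` prime): reducing the output of `kerVecMod`
modulo `p` gives `ListGauss.kerVec` on the reduced rows. [cite: KnuthTAOCP2, §4.6.2, Algorithm N] -/
theorem kerVecMod_eq_kerVec : ∀ (n : ℕ) (rows : List (List ℤ)),
    (kerVecMod p n rows).map (castVec p) = kerVec n (castRows p rows)
  | 0, rows => by simp [kerVecMod, kerFwdRun]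
  | n + 1, rows => by
    rw [kerVecMod_succ, kerVec_succ]
    have hfind : (castRows p rows).find? (fun r => decide (r.headD 0 ≠ 0)) =
        (rows.find? (fun r => decide (r.headD 0 % (p : ℤ) ≠ 0))).map (castVec p) := by
      rw [castRows, List.find?_map]
      congr 2
      funext r
      simp only [Function.comp_apply]
      exact headTest_castVec p r
    rw [hfind]
    cases h : rows.find? (fun r => decide (r.headD 0 % (p : ℤ) ≠ 0)) with
    | none => simp [castVec]
    | some piv =>
      have hpiv := head_ne_zero_of_find h
      simp only [Option.map_some]
      rw [← castRows_elimRowsMod piv hpiv, ← kerVecMod_eq_kerVec n (elimRowsMod p piv rows), Option.map_map, Option.map_map]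
      congr 1
      funext v
      simp only [Function.comp_apply]
      rw [castVec_backSub piv hpiv]

/-- **Soundness**: a vector returned by `kerVecMod` has length `n`, is nonzero modulo `p`, and is
orthogonal modulo `p` to every row (rows of length `n`). [cite: KnuthTAOCP2, §4.6.2, Algorithm N] -/
theorem kerVecMod_sound {n : ℕ} {rows : List (List ℤ)} (hrows : ∀ r ∈ rows, r.length = n) {v : List ℤ}
    (h : kerVecMod p n rows = some v) :
    v.length = n ∧ (∃ x ∈ v, ((x : ℤ) : ZMod p) ≠ 0) ∧ ∀ r ∈ rows, ((idot r v : ℤ) : ZMod p) = 0 := by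
  have hK : kerVec n (castRows p rows) = some (castVec p v) := by
    rw [← kerVecMod_eq_kerVec, h, Option.map_some]
  have hrows' : ∀ r ∈ castRows p rows, r.length = n := by
    intro r hr
    obtain ⟨r', hr', rfl⟩ := List.mem_map.1 hr
    rw [length_castVec, hrows r' hr']
  refine ⟨?_, ?_, fun r hr => ?_⟩
  · simpa using length_of_kerVec_eq_some _ _ _ hK
  · obtain ⟨x, hx, hx0⟩ := exists_ne_zero_of_kerVec_eq_some _ _ _ hK
    obtain ⟨y, hy, rfl⟩ := List.mem_map.1 hx
    exact ⟨y, hy, hx0⟩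
  · rw [cast_idot]
    exact dot_eq_zero_of_kerVec_eq_some n _ hrows' _ hK _ (List.mem_map.2 ⟨r, hr, rfl⟩)

/-- **Completeness**: if some vector of length `n`, nonzero modulo `p`, is orthogonal modulo `p`
to all rows (of length `n`), then `kerVecMod` returns a vector. [cite: KnuthTAOCP2, §4.6.2, Algorithm N] -/
theorem kerVecMod_complete {n : ℕ} {rows : List (List ℤ)} (hrows : ∀ r ∈ rows, r.length = n)
    (u : List (ZMod p)) (hu : u.length = n) (hne : ∃ x ∈ u, x ≠ 0) (horth : ∀ r ∈ rows, dot (castVec p r) u = 0) :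
    (kerVecMod p n rows).isSome = true := by
  have hrows' : ∀ r ∈ castRows p rows, r.length = n := by
    intro r hr
    obtain ⟨r', hr', rfl⟩ := List.mem_map.1 hr
    rw [length_castVec, hrows r' hr']
  have h := isSome_kerVec n (castRows p rows) hrows' u hu hne (fun r hr => by
    obtain ⟨r', hr', rfl⟩ := List.mem_map.1 hr
    exact horth r' hr')
  rw [← kerVecMod_eq_kerVec] at h
  simpa using h

end Equiv

/-! ### Reducedness of the output -/

section Bounds

variable {p : ℕ}

/-- All entries of all rows lie in `[0, p)`. [folklore] -/
def ReducedRows (p : ℕ) (rows : List (List ℤ)) : Prop := ∀ r ∈ rows, Reduced p r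

/-- Elimination outputs reduced rows (`p ≥ 1`). [folklore] -/
theorem reducedRows_elimRowsMod (hp : 0 < p) (piv : List ℤ) (rows : List (List ℤ)) : ReducedRows p (elimRowsMod p piv rows) := by
  intro r hr
  obtain ⟨r', -, rfl⟩ := List.mem_map.1 hr
  intro x hx
  obtain ⟨i, hi, rfl⟩ := List.mem_iff_getElem.1 (List.mem_of_mem_tail hx)
  rw [List.getElem_zipWith]
  have hp' : (0 : ℤ) < p := by exact_mod_cast hp
  exact ⟨Int.emod_nonneg _ hp'.ne', Int.emod_lt_of_pos _ hp'⟩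

/-- Elimination shortens every row by one and keeps the number of rows. [folklore] -/
theorem length_elimRowsMod (piv : List ℤ) (rows : List (List ℤ)) :
    (elimRowsMod p piv rows).length = rows.length ∧ ∀ r ∈ elimRowsMod p piv rows, r.length ≤ piv.length := by
  refine ⟨List.length_map _, fun r hr => ?_⟩
  obtain ⟨r', -, rfl⟩ := List.mem_map.1 hr
  rw [List.length_tail, List.length_zipWith]
  omega

/-- Back-substitution outputs reduced entries on reduced input (`p ≥ 1`). [folklore] -/
theorem reduced_backSub (hp : 0 < p) (piv : List ℤ) {v : List ℤ} (hv : Reduced p v) : Reduced p (backSub p piv v) := by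
  intro x hx
  rcases List.mem_cons.1 hx with rfl | hx
  · have hp' : (0 : ℤ) < p := by exact_mod_cast hp
    exact ⟨Int.emod_nonneg _ hp'.ne', Int.emod_lt_of_pos _ hp'⟩
  · exact hv x hx

end Bounds

end LLLFactoring

end Literature.Computability.Complexity
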